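import Literature.Computability.AlgebraicComplexity.OneSliceSpeedup
import Literature.Computability.AlgebraicComplexity.FlatteningBound
import HarnessLib

/-!
# Appending a one-slice tensor to a restriction (Alman–Li 2026, Prop. 5.4), explicit form

Topic `Literature/Computability/AlgebraicComplexity` (family `MatrixMultiplication`). Source: J. Alman,
B. Li, *Asymptotic Rank Speedup Theorems, Revisited*, arXiv:2605.21738 (2026), §5.3, Proposition 5.4
("One-slice speedup [Str88AsymSpec]") with its printed proof (held text `paper:arxiv-2605.21738`,
p. 13 L64 – p. 14 L20), read first-hand; companion of `AlmanLi2026FreeLunchSpeedup.lean` (Thm. 5.1 /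
Cor. 5.1) and of `OneSliceSpeedup.lean` (the tree's explicit weak instance of Thm. 6.1).

## The printed statement (p. 13)

"Proposition 5.4 (One-slice speedup [Str88AsymSpec]). Let `T ≤ S` be a restriction defined by maps
`A, B, C`. For a linear function `f : W → 𝔽`, let `q = Rk((id_U ⊗ id_V ⊗ f)S)` be the rank of the
corresponding matrix in `U ⊗ V`, and let `s = Rk((A ⊗ B ⊗ f)S)` be the rank of the matrix in
`U' ⊗ V'`. Then there exists a restriction `T ≤ S ⊕ ⟨1,s,1⟩` extending `A, B, C`, such that there
exists a linear function `f' : (W ⊕ 𝔽) → 𝔽` (where `W ⊕ 𝔽` corresponds to the third mode of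
`S ⊕ ⟨1,s,1⟩`) satisfying the conditions of (prop:freelunch_oneslice) with `r = q+s`."
Printed proof (p. 13 L73 – p. 14 L20): "Since `M = (A ⊗ B ⊗ f)S` has rank `s`, there exist linear maps
`A' : 𝔽^s → U'` and `B' : 𝔽^s → V'` such that `M = (A' ⊗ B')⟨1,s,1⟩`. […] we can define the new
restriction as `T = [(A A') ⊗ (B B') ⊗ (C 0)](S ⊕ ⟨1,s,1⟩)`, with the new linear function
`f' = (f −1)`. This function lies in the appropriate kernel, since
`[(A A') ⊗ (B B') ⊗ (f −1)](S ⊕ ⟨1,s,1⟩) = M − (A' ⊗ B')⟨1,s,1⟩ = 0`, and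
`(id ⊗ id ⊗ f')(S ⊕ ⟨1,s,1⟩)` is the direct sum of the matrices `(id_U ⊗ id_V ⊗ f)S` and `⟨1,s,1⟩`,
which has rank `r = q + s`."

## The form proved here (coordinates, any commutative ring `K`)

The factorisation `M = (A' ⊗ B')⟨1,s,1⟩` is taken as DATA: matrices `P : ι' → σ → K`,
`Q : κ' → σ → K` on a finite index type `σ` (`|σ| = s`) with
`∑_{a,b,c} A a' a · B b' b · f c · S a b c = ∑_i P a' i · Q b' i` (`hM`; over a field such `P, Q`
exist exactly when `s ≥ Rk M`, so the printed `s = Rk M` is the least admissible `σ`). The slice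
`⟨1,s,1⟩` with its trivial mode THIRD (the paper's convention; the tree's `oneSliceTensor K σ` of
`OneSliceSpeedup.lean` has it first) is `sliceTensor₃ K σ = rotate (oneSliceTensor K σ) : σ → σ → Unit → K`
(written as the lambda `fun x y _ => if x = y then 1 else 0`; `AlmanLi2026.sliceTensor₃_eq_rotate`).
Then (`AlmanLi2026.prop54_restriction`) `T = [(A P) ⊗ (B Q) ⊗ (C 0)](S ⊕ ⟨1,s,1⟩)`;
(`AlmanLi2026.prop54_annihilates`) the functional `f' = (f, −1)` satisfies
`[(A P) ⊗ (B Q) ⊗ f'](S ⊕ ⟨1,s,1⟩) = 0`; (`AlmanLi2026.prop54_contraction`) the matrix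
`(id ⊗ id ⊗ f')(S ⊕ ⟨1,s,1⟩)` is block-diagonal with blocks `(id ⊗ id ⊗ f)S` and `−1_σ` (its rank
`q + s` over a field is the printed `r`; the rank count itself, like Prop. 5.3, is not formalised);
so that Thm. 5.1 of the companion file (`AlmanLi2026.thm51`, whose hypothesis `hC'` is exactly
`prop54_annihilates` and whose `hT` is `prop54_restriction`) applies to the data `((A P), (B Q), (C 0))`,
`C' = f'`: for any matrices `A'', B''` whose rows satisfy the two annihilator conditions,
`T ⊕ T' ⊴ S ⊕ ⟨1,s,1⟩` with `T' = (A'' ⊗ B'' ⊗ f')(S ⊕ ⟨1,s,1⟩)` (that one-line application is left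
to the file importing both, to keep this file independent of the companion's build).

## References

* J. Alman, B. Li, arXiv:2605.21738 (2026), Prop. 5.4 and its proof (pp. 13–14); Thm. 5.1.
  [AlmanLi2026]
* V. Strassen, *The asymptotic spectrum of tensors*, J. reine angew. Math. 384 (1988) 102–152 (the
  attribution "[Str88AsymSpec]" of the proposition). [Strassen1988]
-/

noncomputable section

open scoped BigOperators

namespace Literature.Computability.AlgebraicComplexity

universe u

variable {K : Type u}
variable {ι κ μ ι' κ' μ' σ α β : Type*}

namespace AlmanLi2026

/-! ## The slice `⟨1,s,1⟩` with trivial third mode is `rotate (oneSliceTensor K σ)` -/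

/-- Entries of `rotate (oneSliceTensor K σ) : σ → σ → Unit → K`: `[x = y]` — the paper's `⟨1,s,1⟩`
with the trivial (`W`-)mode third. [cite: AlmanLi2026, §5.3] -/
theorem rotate_oneSliceTensor_apply [CommSemiring K] [DecidableEq σ] (x y : σ) (u : Unit) :
    rotate (oneSliceTensor K σ) x y u = if x = y then 1 else 0 := by
  simp [rotate_apply, oneSliceTensor_apply]

/-- Mixed block `(inl, inl, inr)` of a direct sum vanishes. [folklore] -/
private theorem directSumTensor_mixed₁₁₂ [CommSemiring K] {ι₁ κ₁ μ₁ ι₂ κ₂ μ₂ : Type*} (s : ι₁ → κ₁ → μ₁ → K)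
    (t : ι₂ → κ₂ → μ₂ → K) (a : ι₁) (b : κ₁) (c : μ₂) :
    directSumTensor s t (Sum.inl a) (Sum.inl b) (Sum.inr c) = 0 := rfl

/-- Mixed block `(inr, inr, inl)` of a direct sum vanishes. [folklore] -/
private theorem directSumTensor_mixed₂₂₁ [CommSemiring K] {ι₁ κ₁ μ₁ ι₂ κ₂ μ₂ : Type*} (s : ι₁ → κ₁ → μ₁ → K)
    (t : ι₂ → κ₂ → μ₂ → K) (a : ι₂) (b : κ₂) (c : μ₁) :
    directSumTensor s t (Sum.inr a) (Sum.inr b) (Sum.inl c) = 0 := rfl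

/-! ## Prop. 5.4 (a): the restriction extends by `(A P) ⊗ (B Q) ⊗ (C 0)` -/

/-- **Alman–Li 2026, Prop. 5.4, first clause**: the restriction `T = (A ⊗ B ⊗ C) S` extends to
`T = [(A P) ⊗ (B Q) ⊗ (C 0)](S ⊕ ⟨1,s,1⟩)` for ANY extra columns `P, Q` (the slice is killed by the
zero third leg). [cite: AlmanLi2026, Prop. 5.4 (proof)] -/
theorem prop54_restriction [CommSemiring K] [Fintype ι] [Fintype κ] [Fintype μ] [Fintype σ]
    [DecidableEq σ] {S : ι → κ → μ → K} {A : ι' → ι → K} {B : κ' → κ → K} {C₀ : μ' → μ → K}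
    {T : ι' → κ' → μ' → K} (P : ι' → σ → K) (Q : κ' → σ → K)
    (hT : ∀ a' b' c', T a' b' c' = ∑ a, ∑ b, ∑ c, A a' a * B b' b * C₀ c' c * S a b c)
    (a' : ι') (b' : κ') (c' : μ') :
    T a' b' c' = ∑ x, ∑ y, ∑ z, Sum.elim (A a') (P a') x * Sum.elim (B b') (Q b') y *
      Sum.elim (C₀ c') (fun _ => (0 : K)) z *
        directSumTensor S (rotate (oneSliceTensor K σ)) x y z := by
  rw [hT]
  simp [Fintype.sum_sum_type, directSumTensor]

/-! ## Prop. 5.4 (b): the extended functional `f' = (f, −1)` annihilates -/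

/-- **Alman–Li 2026, Prop. 5.4, the kernel condition**: if `M = (A ⊗ B ⊗ f) S` factors as
`M = (P ⊗ Q)⟨1,s,1⟩`, i.e. `M a' b' = ∑_i P a' i · Q b' i`, then the functional `f' = (f, −1)` on
`W ⊕ K` satisfies `[(A P) ⊗ (B Q) ⊗ f'](S ⊕ ⟨1,s,1⟩) = M − (P ⊗ Q)⟨1,s,1⟩ = 0`.
[cite: AlmanLi2026, Prop. 5.4 (proof)] -/
theorem prop54_annihilates [CommRing K] [Fintype ι] [Fintype κ] [Fintype μ] [Fintype σ]
    [DecidableEq σ] {S : ι → κ → μ → K} {A : ι' → ι → K} {B : κ' → κ → K} {f : μ → K}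
    {P : ι' → σ → K} {Q : κ' → σ → K}
    (hM : ∀ a' b', (∑ a, ∑ b, ∑ c, A a' a * B b' b * f c * S a b c) = ∑ i, P a' i * Q b' i)
    (a' : ι') (b' : κ') (z : Unit) :
    (∑ x, ∑ y, ∑ w, Sum.elim (A a') (P a') x * Sum.elim (B b') (Q b') y *
      (fun _ : Unit => Sum.elim f (fun _ : Unit => (-1 : K))) z w *
        directSumTensor S (rotate (oneSliceTensor K σ)) x y w) = 0 := by
  simp only [Fintype.sum_sum_type, Fintype.sum_unique, Sum.elim_inl, Sum.elim_inr,
    directSumTensor_inl, directSumTensor_inr, directSumTensor_inl_inr, directSumTensor_inr_inl,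
    directSumTensor_mixed₁₁₂, directSumTensor_mixed₂₂₁, rotate_oneSliceTensor_apply, mul_zero,
    Finset.sum_const_zero, add_zero, zero_add]
  simp only [mul_ite, mul_one, mul_zero, Finset.sum_ite_eq, Finset.mem_univ, if_true]
  rw [hM, ← Finset.sum_add_distrib]
  exact Finset.sum_eq_zero fun i _ => by ring

/-! ## Prop. 5.4 (c): the contraction `(id ⊗ id ⊗ f')(S ⊕ ⟨1,s,1⟩)` is block diagonal -/

/-- **Alman–Li 2026, Prop. 5.4, the fullness clause** in block form: the matrix
`(id ⊗ id ⊗ f')(S ⊕ ⟨1,s,1⟩)` on `(ι ⊕ σ) × (κ ⊕ σ)` is the block-diagonal sum of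
`(id ⊗ id ⊗ f) S` and `−1_σ` ("the direct sum of the matrices `(id_U ⊗ id_V ⊗ f)S` and `⟨1,s,1⟩`,
which has rank `r = q + s`"; the rank count is not formalised here).
[cite: AlmanLi2026, Prop. 5.4 (proof)] -/
theorem prop54_contraction [CommRing K] [Fintype ι] [Fintype κ] [Fintype μ] [Fintype σ]
    [DecidableEq σ] (S : ι → κ → μ → K) (f : μ → K) (x : ι ⊕ σ) (y : κ ⊕ σ) :
    (∑ w, Sum.elim f (fun _ : Unit => (-1 : K)) w * directSumTensor S (rotate (oneSliceTensor K σ)) x y w)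
      = Sum.elim (fun a => Sum.elim (fun b => ∑ c, f c * S a b c) (fun _ => 0) y)
          (fun i => Sum.elim (fun _ => 0) (fun j => if i = j then -1 else 0) y) x := by
  rcases x with a | i <;> rcases y with b | j <;>
    simp [Fintype.sum_sum_type]

end AlmanLi2026

end Literature.Computability.AlgebraicComplexity
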